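import Mathlib.Analysis.SpecialFunctions.Exp
import Mathlib.MeasureTheory.Measure.Lebesgue.Basic
import Literature.MathematicalPhysics.QuantumFieldTheory.Balaban1983to89.T4ShellMeasure

/-!
# N21 (NE7c) · THE GRADED-EXTERIOR PROFILE LETTER: (M1) survives a tilt of bounded oscillation, and a tilt forces
# the shell fraction (lens Card 88 ∕ ROW P⁗′) — plus the Lebesgue letter and the tilted letter in served vocabulary

R141 (C) seat pub-ymgap-dag-n21-e (g16), node N21 = NE7c (single-run shell-weight bound, NOT PRINTED in [Bałaban
1983–89], NOT proved), strategy s3 ALTERNATIVE CURRENCY, lane K3⁷ `SpineGivenEndpointR13SepCoPH`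
(stmt-QuantumFields-20544, `--kind proof --supports … --as helper`).  Part 38o of this seat's series.  §1 of THIS FILE
= §B of the lens's `Sketch-nearmiss-g30.lean` (LENS-nearmiss v30.0 ROW P⁗′, sha16 82e90cfc31fec086; first refusal
dag-n21-e; farm rc 0 · 0 warnings at the lens desk) VERBATIM — statements and proofs — re-homed in this namespace.
AUTHORSHIP OF THE MATHEMATICS OF §1: planner seat `ym-lens-BalabanUVNodes-nearmiss` g30 (memo-only seat, cannot
file; lapsed 22:40Z per director-ym LINE №196); this seat files it and adds §2.

WHAT (lens Card 88, state W²⁹: «(M1) at a lettered site IS the profile letter»).  §1: the linear centre's size ∕ the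
fibre tilt at a block site is a kernel-row × exterior-size pairing `Λ_b ≤ Σ_y |A_by| Θ_y` (`abs_response_le_profile`);
the violated letters sit inside the layer where that pairing exceeds the threshold (`violated_subset_layer`); the
tilted Gaussian fibre has log-oscillation `≤ ½A_bbθ² + 2θΛ_b` over its letter (`fibre_logOsc_le`); (M1) survives a tilt
with `D` multiplied by the density's sup ∕ inf ratio (★ `slotAntiConcentration_withDensity_of_ratio`, typed against
the SERVED `T4ShellMeasure.SlotAntiConcentration`); conversely a tilt `Λ` puts the fraction `≥ 1 − e^{−Λθρ}` of the
letter's mass in the shell (`tiltedShellFraction_ge`), forcing `Dρ ≥ 1 − e^{−Λθρ}`.  §1′ = lens g31's CORRECTION OF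
RECORD (Sketch-nearmiss-g31 §A VERBATIM, sha16 4d0310747a04feda): the matching upper bound `≤ ρ(Λθ + ½)`
(`tiltedShellFraction_le`, `tiltedShellFraction_twoSided`) — the (M1) constant of a tilted fibre is TWO-SIDEDLY LINEAR
in the tilt work, `D ≍ Λθ`, not exponential; `linear_le_ratioBound`.  §2 (this seat): the ratio lemma
with the density bounded only ON the carrying set (`slotAntiConcentration_withDensity_of_ratio_on`); the one-sided
Lebesgue letter `[−θ, θ]` satisfies (M1) with `D = ½` (`slotAntiConcentration_lebesgueLetter`); hence ★ the TILTED
LETTER — density `e^{−(½at² + ht)}` on `[−θ, θ]`, `a ≥ 0` — satisfies (M1) with `D = ½·e^{2(½aθ² + 2θ|h|)}`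
(`slotAntiConcentration_tiltedLetter`; the anchor `s = 0` costs the factor `2` in the exponent against the sharp
sup ∕ inf ratio), with every binder discharged (A6, director-ym STANDING A6 RULE №189 (3)); and the TWO-SIDED letter
(statistic `|t|`, the collar road's kept letters of 38k ∕ part 30 §C): `D = 1` untilted
(`slotAntiConcentration_lebesgueLetter_abs`), ★ `D = e^{2·osc}` tilted (`slotAntiConcentration_tiltedLetter_abs`).

HONEST FRAMING.  [textbook] measure theory ∕ calculus; 0 def, 0 sorry; the profile pairing `Λ_b`, the thresholds and
the exterior sizes `Θ_y` are the LENS's packaging — NOT-IN-PRINT as one function (lit-balaban desk ROW Q″ answer of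
record, iface-1 g169 ∕ lead g28): print has six located source ∕ receiver clauses, [Balaban1989LargeFieldI] (CMP 122)
pp. 184–186 (1.37)–(1.48), tree rows `B15.PrelimIntegrations` (1.37) ∕ (1.38) ∕ (1.42) ∕ (1.45) ∕ (1.47) ∕ (1.48)
PROVED — cited here as located MECHANISM only, none asserted, none consumed; nothing of Bałaban's asserted; NE7c NOT
PRINTED ∕ NOT proved; N21 NOT discharged; counts unmoved (typed 28∕28 · discharged 5∕27); count-neutral; one finite 𝕋⁴
at fixed ε — nothing about ℝ⁴ ∕ OS ∕ mass gap ∕ Clay.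
-/

set_option autoImplicit false

open Set MeasureTheory
open Literature.MathematicalPhysics.QuantumFieldTheory.Balaban1983to89
  (T4ShellMeasure.SlotAntiConcentration T4ShellMeasure.shell_eq_preimage)

namespace Summit.QuantumFields.YangMills.Theorems.N21TiltedFibreProfile

/-! ## §1  Lens Card 88 (Sketch-nearmiss-g30 §B, VERBATIM WITH CREDIT) — the graded-exterior profile letter -/

section Profile

variable {κ Y : Type*} [Fintype Y]

omit [Fintype Y] in
/-- **THE LINEAR CENTRE IS A KERNEL ∕ EXTERIOR-SIZE PAIRING.**  `|Σ_y R_by z_y| ≤ Σ_y |R_by| Θ_y` for `|z_y| ≤ Θ_y`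
(`Θ_y` = the size permitted to the exterior variable `y` — threshold if lettered, chart radius if not; `R = A_κκ⁻¹A_κ,ext`).
[textbook] -/
theorem abs_response_le_profile [Fintype Y] (R : κ → Y → ℝ) (z Θ : Y → ℝ) (hz : ∀ y, |z y| ≤ Θ y) (b : κ) :
    |∑ y, R b y * z y| ≤ ∑ y, |R b y| * Θ y := by
  refine (Finset.abs_sum_le_sum_abs _ _).trans (Finset.sum_le_sum fun y _ => ?_)
  rw [abs_mul]
  exact mul_le_mul_of_nonneg_left (hz y) (abs_nonneg _)

omit [Fintype Y] in
/-- **THE VIOLATED LETTERS SIT IN THE LAYER WHERE THE PROFILE PAIRING EXCEEDS THE THRESHOLD.**  If beyond depth `w₁`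
the pairing is below the letter's threshold, `J₁ = {b : θ_b < |m_b|} ⊆ {d < w₁}`. [bookkeeping] -/
theorem violated_subset_layer (m θ P : κ → ℝ) (d : κ → ℕ) (w₁ : ℕ)
    (hm : ∀ b, |m b| ≤ P b) (hP : ∀ b, w₁ ≤ d b → P b ≤ θ b) :
    {b | θ b < |m b|} ⊆ {b | d b < w₁} := by
  intro b hb
  simp only [mem_setOf_eq] at hb ⊢
  by_contra h
  exact absurd ((hm b).trans (hP b (not_lt.1 h))) (not_le.2 hb)

/-- **LOG-OSCILLATION OF A TILTED GAUSSIAN FIBRE OVER ITS LETTER.**  For `q(t) = ½at² + ht` (`a ≥ 0`) and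
`|t|, |s| ≤ θ`: `q t − q s ≤ ½aθ² + 2θ|h|` — so the fibre density `e^{−q}` has sup ∕ inf ratio `≤ e^{½aθ² + 2θ|h|}` on the
letter, with `|h| ≤ Σ_y |A_by| Θ_y` the profile pairing (`abs_response_le_profile`). [textbook] -/
theorem fibre_logOsc_le {a h θ t s : ℝ} (ha : 0 ≤ a) (ht : |t| ≤ θ) (hs : |s| ≤ θ) :
    (a / 2 * t ^ 2 + h * t) - (a / 2 * s ^ 2 + h * s) ≤ a / 2 * θ ^ 2 + 2 * θ * |h| := by
  have hθ : 0 ≤ θ := (abs_nonneg t).trans ht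
  have h1 : t ^ 2 ≤ θ ^ 2 := by rw [← sq_abs]; exact pow_le_pow_left₀ (abs_nonneg _) ht 2
  have h2 : h * t - h * s ≤ 2 * θ * |h| := by
    rw [← mul_sub]
    refine (le_abs_self _).trans ?_
    rw [abs_mul]
    have hts : |t - s| ≤ 2 * θ := (abs_sub _ _).trans (by linarith)
    nlinarith [abs_nonneg h, abs_nonneg (t - s)]
  nlinarith [sq_nonneg s]

/-- ★ **(M1) IS STABLE UNDER A TILT OF BOUNDED OSCILLATION — served vocabulary.**  If the untilted fibre law `μ₀`
satisfies `SlotAntiConcentration μ₀ u θ ρ c` and the density `f` has `0 < m ≤ f ≤ M`, then the tilted law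
`μ₀.withDensity f` satisfies it with `D = (M∕m)·c`.  With `fibre_logOsc_le`: at a lettered site the (M1) constant is
at most `½·e^{½A_bbθ_b² + 2θ_bΛ_b}` (`c = ½` for the Lebesgue fibre), `Λ_b` = the profile pairing — the UPPER half of
«(M1) ⟺ the profile letter»; `tiltedShellFraction_ge` is the LOWER half.  [lens g31 CORRECTION OF RECORD, bus
l.23923: the ratio transfer is SHARP only for bounded-oscillation factors (the non-Gaussian correction `e^{−P}`); for
the tilt itself the (M1) constant is LINEAR in the tilt work — `tiltedShellFraction_le` below and, in served vocabulary,
n21-d part 8 `…N21HazardFromLogLipschitz.slotAntiConcentration_iSup_pi_of_logLipschitz` (`D = e·Λ_slope·θ`).]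
[textbook measure theory] -/
theorem slotAntiConcentration_withDensity_of_ratio {Ω : Type*} [MeasurableSpace Ω] (μ₀ : Measure Ω)
    {u : Ω → ℝ} (hu : Measurable u) {θ ρ c m M : ℝ} (f : Ω → ℝ) (hm : 0 < m) (hmM : m ≤ M)
    (hmf : ∀ x, m ≤ f x) (hfM : ∀ x, f x ≤ M) (h₀ : T4ShellMeasure.SlotAntiConcentration μ₀ u θ ρ c) :
    T4ShellMeasure.SlotAntiConcentration (μ₀.withDensity fun x => ENNReal.ofReal (f x)) u θ ρ (M / m * c) := by
  unfold T4ShellMeasure.SlotAntiConcentration at h₀ ⊢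
  have hT : MeasurableSet {x | θ * (1 - ρ) ≤ u x ∧ u x < θ} := by
    rw [T4ShellMeasure.shell_eq_preimage]; exact hu measurableSet_Ico
  rw [withDensity_apply _ hT, withDensity_apply _ MeasurableSet.univ, Measure.restrict_univ]
  have h1 : ∫⁻ x in {x | θ * (1 - ρ) ≤ u x ∧ u x < θ}, ENNReal.ofReal (f x) ∂μ₀
      ≤ ENNReal.ofReal M * μ₀ {x | θ * (1 - ρ) ≤ u x ∧ u x < θ} := by
    calc ∫⁻ x in {x | θ * (1 - ρ) ≤ u x ∧ u x < θ}, ENNReal.ofReal (f x) ∂μ₀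
        ≤ ∫⁻ _ in {x | θ * (1 - ρ) ≤ u x ∧ u x < θ}, ENNReal.ofReal M ∂μ₀ :=
          lintegral_mono fun x => ENNReal.ofReal_le_ofReal (hfM x)
      _ = ENNReal.ofReal M * μ₀ {x | θ * (1 - ρ) ≤ u x ∧ u x < θ} := setLIntegral_const _ _
  have h2 : ENNReal.ofReal m * μ₀ Set.univ ≤ ∫⁻ x, ENNReal.ofReal (f x) ∂μ₀ := by
    calc ENNReal.ofReal m * μ₀ Set.univ = ∫⁻ _, ENNReal.ofReal m ∂μ₀ := (lintegral_const _).symm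
      _ ≤ ∫⁻ x, ENNReal.ofReal (f x) ∂μ₀ := lintegral_mono fun x => ENNReal.ofReal_le_ofReal (hmf x)
  have hM : 0 ≤ M := hm.le.trans hmM
  have key : ENNReal.ofReal M * ENNReal.ofReal (c * ρ)
      = ENNReal.ofReal (M / m * c * ρ) * ENNReal.ofReal m := by
    rw [← ENNReal.ofReal_mul hM, ← ENNReal.ofReal_mul' hm.le]
    congr 1
    rw [show M / m * c * ρ * m = M / m * m * (c * ρ) by ring, div_mul_cancel₀ _ hm.ne']
  calc ∫⁻ x in {x | θ * (1 - ρ) ≤ u x ∧ u x < θ}, ENNReal.ofReal (f x) ∂μ₀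
      ≤ ENNReal.ofReal M * μ₀ {x | θ * (1 - ρ) ≤ u x ∧ u x < θ} := h1
    _ ≤ ENNReal.ofReal M * (ENNReal.ofReal (c * ρ) * μ₀ Set.univ) := mul_le_mul' le_rfl h₀
    _ = ENNReal.ofReal (M / m * c * ρ) * (ENNReal.ofReal m * μ₀ Set.univ) := by
        rw [← mul_assoc, key, mul_assoc]
    _ ≤ ENNReal.ofReal (M / m * c * ρ) * ∫⁻ x, ENNReal.ofReal (f x) ∂μ₀ := mul_le_mul' le_rfl h2

/-- **THE TILTED FIBRE PUTS ALMOST ALL OF THE LETTER'S MASS IN THE (M1) SHELL.**  For the density `e^{Λy}` on `[−θ, θ]`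
(`Λ > 0`: an un-lettered neighbour of size `≈ Λ∕Γ₁` beyond the letter), the fraction of mass in `[θ(1−ρ), θ)` is
`(e^{Λθ} − e^{Λθ(1−ρ)})∕(e^{Λθ} − e^{−Λθ}) ≥ 1 − e^{−Λθρ}`; so `SlotAntiConcentration` with constant `D` forces
`Dρ ≥ 1 − e^{−Λθρ}`, i.e. `D ≳ min(Λθ, ρ⁻¹)`.  Scenario (b) of Card 88 (Λ ~ Γ₁∕g) is therefore fatal and must be
excluded by print's geometry; scenario (c) (Λ ~ Γ₁·Cθ) gives `D ~ Cθ²` — polylogarithmic.  [lens g31, bus l.23923: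
scenario (b) EXCLUDED AS PRINTED ([Balaban1989LargeFieldI] (1.38) ∕ (1.42) ∕ (1.45) ∕ (1.47) ∕ (1.48), tree rows
PROVED); the matching UPPER bound `≤ ρ(Λθ + ½)` is `tiltedShellFraction_le` (§1′).] [textbook calculus] -/
theorem tiltedShellFraction_ge {Λ θ ρ : ℝ} (hΛ : 0 < Λ) (hθ : 0 < θ) (hρ : 0 < ρ) :
    1 - Real.exp (-(Λ * θ * ρ))
      ≤ (Real.exp (Λ * θ) - Real.exp (Λ * θ * (1 - ρ))) / (Real.exp (Λ * θ) - Real.exp (-(Λ * θ))) := by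
  have hΛθ : 0 < Λ * θ := mul_pos hΛ hθ
  have hD : 0 < Real.exp (Λ * θ) - Real.exp (-(Λ * θ)) := by
    rw [sub_pos, Real.exp_lt_exp]; linarith
  rw [le_div_iff₀ hD]
  have h1 : Real.exp (-(Λ * θ * ρ)) * Real.exp (Λ * θ) = Real.exp (Λ * θ * (1 - ρ)) := by
    rw [← Real.exp_add]; congr 1; ring
  have h2 : Real.exp (-(Λ * θ * ρ)) * Real.exp (-(Λ * θ)) = Real.exp (-(Λ * θ * (1 + ρ))) := by
    rw [← Real.exp_add]; congr 1; ring
  have h3 : Real.exp (-(Λ * θ * (1 + ρ))) ≤ Real.exp (-(Λ * θ)) := by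
    rw [Real.exp_le_exp]; nlinarith
  nlinarith [h1, h2, h3, Real.exp_pos (-(Λ * θ * ρ))]

end Profile

/-! ## §1′  Lens g31 CORRECTION OF RECORD (Sketch-nearmiss-g31 §A, VERBATIM WITH CREDIT): the shell fraction of a
tilted fibre is TWO-SIDEDLY LINEAR in the tilt work -/

section TiltLinear

/-- ★ **PURE-TILT FIBRE: SHELL FRACTION ≤ ρ·(Λθ + ½).**  For the density `e^{Λy}` on `[−θ, θ]` (`Λ > 0`) the fraction of
mass in the (M1) shell `[θ(1−ρ), θ)` is `(e^{Λθ} − e^{Λθ(1−ρ)})∕(e^{Λθ} − e^{−Λθ}) ≤ ρ(Λθ + ½)` for every `ρ ≥ 0`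
(from `1 − e^{−Λθρ} ≤ Λθρ` and `1 − e^{−2Λθ} ≥ 2Λθ∕(1 + 2Λθ)`).  With Sketch-g30 `tiltedShellFraction_ge`
(`≥ 1 − e^{−Λθρ}`) this pins the (M1) constant of the tilted fibre TWO-SIDEDLY LINEAR: `D ≍ Λθ` (for `Λθρ ≤ 1 ≤ Λθ`),
correcting LENS v30.0 N205's «log D ≍ θΛ»: (M1) with polylogarithmic `D` at a lettered site ⟺ `θ_bΛ_b ≤ polylog`.
(Mathematics: lens seat `ym-lens-BalabanUVNodes-nearmiss` g31, `Sketch-nearmiss-g31.lean` sha16 4d0310747a04feda,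
statement and proof verbatim.) [textbook calculus] -/
theorem tiltedShellFraction_le {Λ θ ρ : ℝ} (hΛ : 0 < Λ) (hθ : 0 < θ) (hρ : 0 ≤ ρ) :
    (Real.exp (Λ * θ) - Real.exp (Λ * θ * (1 - ρ))) / (Real.exp (Λ * θ) - Real.exp (-(Λ * θ)))
      ≤ ρ * (Λ * θ + 1 / 2) := by
  set x := Λ * θ with hx
  have hx0 : 0 < x := mul_pos hΛ hθ
  have hD : 0 < Real.exp x - Real.exp (-x) := by
    rw [sub_pos, Real.exp_lt_exp]; linarith
  rw [div_le_iff₀ hD]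
  -- the numerator: `e^x − e^{x(1−ρ)} = e^x (1 − e^{−xρ}) ≤ e^x · xρ`
  have h1 : Real.exp (x * (1 - ρ)) = Real.exp x * Real.exp (-(x * ρ)) := by
    rw [← Real.exp_add]; congr 1; ring
  have hm : 1 - x * ρ ≤ Real.exp (-(x * ρ)) := by
    have := Real.add_one_le_exp (-(x * ρ)); linarith
  have hex : 0 < Real.exp x := Real.exp_pos x
  have hnum : Real.exp x - Real.exp (x * (1 - ρ)) ≤ Real.exp x * (x * ρ) := by
    rw [h1]
    have : Real.exp x * (1 - Real.exp (-(x * ρ))) ≤ Real.exp x * (x * ρ) :=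
      mul_le_mul_of_nonneg_left (by linarith) hex.le
    linarith
  -- the denominator: `(2x + 1) e^{−x} ≤ e^x`, i.e. `1 − e^{−2x} ≥ 2x∕(1+2x)`
  have hinv : Real.exp x * Real.exp (-x) = 1 := by
    rw [← Real.exp_add, add_neg_cancel, Real.exp_zero]
  have h2x : 2 * x + 1 ≤ Real.exp x * Real.exp x := by
    have h := Real.add_one_le_exp (2 * x)
    have : Real.exp (2 * x) = Real.exp x * Real.exp x := by rw [← Real.exp_add]; ring_nf
    linarith [this]
  have h4 : (2 * x + 1) * Real.exp (-x) ≤ Real.exp x := by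
    have hneg : 0 ≤ Real.exp (-x) := (Real.exp_pos _).le
    calc (2 * x + 1) * Real.exp (-x) ≤ (Real.exp x * Real.exp x) * Real.exp (-x) :=
          mul_le_mul_of_nonneg_right h2x hneg
      _ = Real.exp x * (Real.exp x * Real.exp (-x)) := by ring
      _ = Real.exp x := by rw [hinv, mul_one]
  have hkey : Real.exp x * x ≤ (x + 1 / 2) * (Real.exp x - Real.exp (-x)) := by nlinarith [h4]
  calc Real.exp x - Real.exp (x * (1 - ρ)) ≤ Real.exp x * (x * ρ) := hnum
    _ = ρ * (Real.exp x * x) := by ring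
    _ ≤ ρ * ((x + 1 / 2) * (Real.exp x - Real.exp (-x))) := mul_le_mul_of_nonneg_left hkey hρ
    _ = ρ * (x + 1 / 2) * (Real.exp x - Real.exp (-x)) := by ring

/-- The two-sided reading in one display: `1 − e^{−Λθρ} ≤ fraction ≤ ρ(Λθ + ½)` (§1 `tiltedShellFraction_ge` ∧ §1′
`tiltedShellFraction_le`). [textbook calculus] -/
theorem tiltedShellFraction_twoSided {Λ θ ρ : ℝ} (hΛ : 0 < Λ) (hθ : 0 < θ) (hρ : 0 < ρ) :
    1 - Real.exp (-(Λ * θ * ρ))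
        ≤ (Real.exp (Λ * θ) - Real.exp (Λ * θ * (1 - ρ))) / (Real.exp (Λ * θ) - Real.exp (-(Λ * θ)))
      ∧ (Real.exp (Λ * θ) - Real.exp (Λ * θ * (1 - ρ))) / (Real.exp (Λ * θ) - Real.exp (-(Λ * θ)))
        ≤ ρ * (Λ * θ + 1 / 2) :=
  ⟨tiltedShellFraction_ge hΛ hθ hρ, tiltedShellFraction_le hΛ hθ hρ.le⟩

/-- **WHY THE DENSITY-RATIO TRANSFER IS THE WRONG TOOL FOR THE LINEAR TILT** (scope note for §1
`slotAntiConcentration_withDensity_of_ratio`, lens g31 verbatim): the ratio bound `M∕m = e^{osc}` is sharp for a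
BOUNDED-oscillation factor but for the tilt `e^{Λy}` on `[−θ, θ]` it gives `e^{2Λθ}` where the truth is `Λθ + ½`;
recorded as the elementary `Λθ + ½ ≤ e^{2Λθ}` (so the linear bound is never worse). [textbook] -/
theorem linear_le_ratioBound {Λ θ : ℝ} (hΛ : 0 ≤ Λ) (hθ : 0 ≤ θ) : Λ * θ + 1 / 2 ≤ Real.exp (2 * (Λ * θ)) := by
  have h := Real.add_one_le_exp (2 * (Λ * θ))
  have : 0 ≤ Λ * θ := mul_nonneg hΛ hθ
  linarith

end TiltLinear

/-! ## §2  (this seat) The ratio lemma with bounds on the carrying set; the Lebesgue letter; ★ the tilted letter -/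

section Letter

/-- **THE RATIO LEMMA WITH THE DENSITY BOUNDED ONLY ON THE CARRYING SET.**  `μ|S` with `0 < m ≤ f ≤ M` on `S`
(measurable `S`, any `f`): (M1) for `μ|S` with constant `c` ⇒ (M1) for `(μ|S).withDensity f` with `(M∕m)·c`
(§1 `slotAntiConcentration_withDensity_of_ratio` applied to `𝟙_S (f − m) + m`, which agrees with `f` `μ|S`-a.e.).
[textbook measure theory] -/
theorem slotAntiConcentration_withDensity_of_ratio_on {Ω : Type*} [MeasurableSpace Ω] (μ : Measure Ω)
    {S : Set Ω} (hS : MeasurableSet S) {u : Ω → ℝ} (hu : Measurable u) {θ ρ c m M : ℝ} {f : Ω → ℝ}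
    (hm : 0 < m) (hmM : m ≤ M) (hmf : ∀ x ∈ S, m ≤ f x) (hfM : ∀ x ∈ S, f x ≤ M)
    (h₀ : T4ShellMeasure.SlotAntiConcentration (μ.restrict S) u θ ρ c) :
    T4ShellMeasure.SlotAntiConcentration ((μ.restrict S).withDensity fun x => ENNReal.ofReal (f x)) u θ ρ
      (M / m * c) := by
  set f' : Ω → ℝ := fun x => S.indicator (fun x => f x - m) x + m with hf'
  have hmf' : ∀ x, m ≤ f' x := by
    intro x
    by_cases hx : x ∈ S
    · simp only [hf', indicator_of_mem hx]; linarith [hmf x hx]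
    · simp only [hf', indicator_of_notMem hx]; linarith
  have hfM' : ∀ x, f' x ≤ M := by
    intro x
    by_cases hx : x ∈ S
    · simp only [hf', indicator_of_mem hx]; linarith [hfM x hx]
    · simp only [hf', indicator_of_notMem hx]; linarith
  have hae : (fun x => ENNReal.ofReal (f' x)) =ᵐ[μ.restrict S] fun x => ENNReal.ofReal (f x) := by
    rw [Filter.EventuallyEq, ae_restrict_iff' hS]
    exact ae_of_all _ fun x hx => by simp only [hf', indicator_of_mem hx, sub_add_cancel]
  rw [← withDensity_congr_ae hae]
  exact slotAntiConcentration_withDensity_of_ratio (μ.restrict S) hu f' hm hmM hmf' hfM' h₀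

/-- **THE ONE-SIDED LEBESGUE LETTER SATISFIES (M1) WITH `D = ½`.**  On `[−θ, θ]` under Lebesgue measure with the
statistic `u t = t` (`θ > 0`, `0 < ρ ≤ 1`): the shell `[θ(1−ρ), θ)` has mass `θρ = (½·ρ)·2θ`. [textbook] -/
theorem slotAntiConcentration_lebesgueLetter {θ ρ : ℝ} (hθ : 0 < θ) (hρ : 0 < ρ) (hρ1 : ρ ≤ 1) :
    T4ShellMeasure.SlotAntiConcentration ((volume : Measure ℝ).restrict (Icc (-θ) θ)) (fun t => t) θ ρ (1 / 2) := by
  unfold T4ShellMeasure.SlotAntiConcentration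
  have hT : MeasurableSet {x : ℝ | θ * (1 - ρ) ≤ x ∧ x < θ} := by
    rw [T4ShellMeasure.shell_eq_preimage]; exact measurable_id measurableSet_Ico
  have hshell : {x : ℝ | θ * (1 - ρ) ≤ x ∧ x < θ} ∩ Icc (-θ) θ = Ico (θ * (1 - ρ)) θ := by
    ext x
    simp only [mem_inter_iff, mem_setOf_eq, mem_Icc, mem_Ico]
    constructor
    · rintro ⟨⟨h1, h2⟩, -⟩; exact ⟨h1, h2⟩
    · rintro ⟨h1, h2⟩
      refine ⟨⟨h1, h2⟩, ?_, h2.le⟩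
      nlinarith
  rw [Measure.restrict_apply hT, Measure.restrict_apply MeasurableSet.univ, univ_inter, hshell, Real.volume_Ico,
    Real.volume_Icc, ← ENNReal.ofReal_mul (by positivity)]
  exact ENNReal.ofReal_le_ofReal (by nlinarith)

/-- ★ **THE TILTED LETTER SATISFIES (M1)** — A6 of §1's ★ with every binder discharged: the fibre density
`e^{−(½at² + ht)}` (`a ≥ 0`, any tilt `h`) on the letter `[−θ, θ]` under Lebesgue measure, statistic `u t = t`,
`0 < ρ ≤ 1`, satisfies `SlotAntiConcentration` with `D = (e^{osc}∕e^{−osc})·½`, `osc = ½aθ² + 2θ|h|` (§1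
`fibre_logOsc_le` anchored at `s = 0`; the sharp sup ∕ inf ratio `e^{osc}` would halve the exponent).  Per lens g31's
correction the better constant for the TILT is LINEAR, `D ≤ e·Λ_slope·θ` with `Λ_slope = aθ + |h|` (n21-d part 8
`…N21HazardFromLogLipschitz.slotAntiConcentration_iSup_pi_of_logLipschitz`, not consumed here); this exponential
form is the one to keep for bounded-oscillation factors — (M1) constant `≤ min(½e^{2·osc}, e·Λ_slope·θ)`. [textbook] -/
theorem slotAntiConcentration_tiltedLetter {a h θ ρ : ℝ} (ha : 0 ≤ a) (hθ : 0 < θ) (hρ : 0 < ρ) (hρ1 : ρ ≤ 1) :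
    T4ShellMeasure.SlotAntiConcentration
      (((volume : Measure ℝ).restrict (Icc (-θ) θ)).withDensity
        fun t => ENNReal.ofReal (Real.exp (-(a / 2 * t ^ 2 + h * t)))) (fun t => t) θ ρ
      (Real.exp (a / 2 * θ ^ 2 + 2 * θ * |h|) / Real.exp (-(a / 2 * θ ^ 2 + 2 * θ * |h|)) * (1 / 2)) := by
  have h0 : |(0 : ℝ)| ≤ θ := by rw [abs_zero]; exact hθ.le
  refine slotAntiConcentration_withDensity_of_ratio_on volume measurableSet_Icc measurable_id
    (Real.exp_pos _) (Real.exp_le_exp.2 (by nlinarith [abs_nonneg h, sq_nonneg θ])) ?_ ?_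
    (slotAntiConcentration_lebesgueLetter hθ hρ hρ1)
  · intro t ht
    have ht' : |t| ≤ θ := abs_le.2 ⟨ht.1, ht.2⟩
    have := fibre_logOsc_le (h := h) ha ht' h0
    refine Real.exp_le_exp.2 ?_
    nlinarith
  · intro t ht
    have ht' : |t| ≤ θ := abs_le.2 ⟨ht.1, ht.2⟩
    have := fibre_logOsc_le (h := h) ha h0 ht'
    refine Real.exp_le_exp.2 ?_
    nlinarith

/-- **THE TWO-SIDED LEBESGUE LETTER SATISFIES (M1) WITH `D = 1`.**  On `[−θ, θ]` under Lebesgue measure with the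
statistic `u t = |t|` (the collar's kept letters `|w_b| < θ_b` of 38k ∕ part 30 §C; any `ρ > 0`): the shell
`{θ(1−ρ) ≤ |t| < θ}` lies in two intervals of length `θρ`, mass `≤ 2θρ = (1·ρ)·2θ`. [textbook] -/
theorem slotAntiConcentration_lebesgueLetter_abs {θ ρ : ℝ} (hθ : 0 < θ) (hρ : 0 < ρ) :
    T4ShellMeasure.SlotAntiConcentration ((volume : Measure ℝ).restrict (Icc (-θ) θ)) (fun t => |t|) θ ρ 1 := by
  unfold T4ShellMeasure.SlotAntiConcentration
  have hT : MeasurableSet {x : ℝ | θ * (1 - ρ) ≤ |x| ∧ |x| < θ} := by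
    rw [T4ShellMeasure.shell_eq_preimage]; exact continuous_abs.measurable measurableSet_Ico
  have hsub : {x : ℝ | θ * (1 - ρ) ≤ |x| ∧ |x| < θ} ∩ Icc (-θ) θ
      ⊆ Ico (θ * (1 - ρ)) θ ∪ Ioc (-θ) (-(θ * (1 - ρ))) := by
    rintro x ⟨⟨h1, h2⟩, -⟩
    rcases le_or_gt 0 x with hx | hx
    · left
      rw [abs_of_nonneg hx] at h1 h2
      exact ⟨h1, h2⟩
    · right
      rw [abs_of_neg hx] at h1 h2
      exact ⟨by linarith, by linarith⟩
  rw [Measure.restrict_apply hT, Measure.restrict_apply MeasurableSet.univ, univ_inter, Real.volume_Icc]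
  calc volume ({x : ℝ | θ * (1 - ρ) ≤ |x| ∧ |x| < θ} ∩ Icc (-θ) θ)
      ≤ volume (Ico (θ * (1 - ρ)) θ ∪ Ioc (-θ) (-(θ * (1 - ρ)))) := measure_mono hsub
    _ ≤ volume (Ico (θ * (1 - ρ)) θ) + volume (Ioc (-θ) (-(θ * (1 - ρ)))) := measure_union_le _ _
    _ = ENNReal.ofReal (θ * ρ) + ENNReal.ofReal (θ * ρ) := by
        rw [Real.volume_Ico, Real.volume_Ioc]
        congr 2 <;> ring
    _ = ENNReal.ofReal (1 * ρ) * ENNReal.ofReal (θ - -θ) := by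
        rw [← ENNReal.ofReal_add (by positivity) (by positivity), ← ENNReal.ofReal_mul (by positivity)]
        congr 1
        ring

/-- ★ **THE TILTED TWO-SIDED LETTER SATISFIES (M1)** — the same for the statistic `u t = |t|` (`D = e^{2·osc}·1`): the
shape the collar road (38k ∕ 38l ∕ 38m) consumes, every binder discharged. [textbook] -/
theorem slotAntiConcentration_tiltedLetter_abs {a h θ ρ : ℝ} (ha : 0 ≤ a) (hθ : 0 < θ) (hρ : 0 < ρ) :
    T4ShellMeasure.SlotAntiConcentration
      (((volume : Measure ℝ).restrict (Icc (-θ) θ)).withDensity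
        fun t => ENNReal.ofReal (Real.exp (-(a / 2 * t ^ 2 + h * t)))) (fun t => |t|) θ ρ
      (Real.exp (a / 2 * θ ^ 2 + 2 * θ * |h|) / Real.exp (-(a / 2 * θ ^ 2 + 2 * θ * |h|)) * 1) := by
  have h0 : |(0 : ℝ)| ≤ θ := by rw [abs_zero]; exact hθ.le
  refine slotAntiConcentration_withDensity_of_ratio_on volume measurableSet_Icc continuous_abs.measurable
    (Real.exp_pos _) (Real.exp_le_exp.2 (by nlinarith [abs_nonneg h, sq_nonneg θ])) ?_ ?_
    (slotAntiConcentration_lebesgueLetter_abs hθ hρ)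
  · intro t ht
    have ht' : |t| ≤ θ := abs_le.2 ⟨ht.1, ht.2⟩
    have := fibre_logOsc_le (h := h) ha ht' h0
    exact Real.exp_le_exp.2 (by nlinarith)
  · intro t ht
    have ht' : |t| ≤ θ := abs_le.2 ⟨ht.1, ht.2⟩
    have := fibre_logOsc_le (h := h) ha h0 ht'
    exact Real.exp_le_exp.2 (by nlinarith)

end Letter

end Summit.QuantumFields.YangMills.Theorems.N21TiltedFibreProfile
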